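import Summits.PneNP.PneNP.Theorems.Sd2BlMachineDictGraph
import Summits.PneNP.PneNP.Theorems.SfmBlMachineDictDecomp

/-!
# K1'' machine side (S3), DICTIONARY D2a (generic): the computed spot decomposition — parts, sides, density, cover

Cell pnp-ideate, ROUND-18 item K1''; twin of `SfmBlMachineDictDecomp` with `trips ↦ raw` and the density
threshold as a PARAMETER `γsq` (the sd-2 machine uses `γsq = gRsq ℓ t = 544ℓ³·4ᵗ·2t`; the pipeline's real threshold
is `√γsq = 4ℓ·√(34ℓ·4ᵗ·2t)`, see `sqrt_mul_sqrt_lt_iff`).  From an extraction state `(labels, r)` of the generic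
extraction (`SfmBlMachine.extract`, one label per pieced leg, `0` = remainder, `s + 1` = spot `s`): `pG e : Option (Fin r)`
(the part of position `e`), `V₁G s`, `V₂G s` (endpoint pieces of the legs of spot `s`), and the clauses (sides)
`srcG_mem_V₁G / dstG_mem_V₂G`, (covered) `card_V₁G_add_card_V₂G_le`, (dense) `dense_V₁G_V₂G` from the spot history
`SpotInv`; bookkeeping `card_filter_pG_eq_some`.  Sparseness and the bundle are D2b.  Restricted-model algorithmic
infrastructure; nothing here bears on `P` versus `NP`.
-/

set_option linter.dupNamespace false -- `Summit.PneNP.PneNP.…`: summit = sub-problem name (D-0017 single-conjunct layout)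

namespace Summit.PneNP.PneNP.Theorems.Sd2BlMachine

open Literature.Computability.Complexity
open Summit.PneNP.PneNP.Theorems.SfmBlMachine (Lab PLeg labL labR Cand SpotInv count_eq_length_filter_range)

/-! ## Real and natural forms of the density test, parametric in `γsq` -/

/-- `√γ · √(a·b) < e` (reals) iff `γ·a·b < e·e` (naturals). -/
theorem sqrt_mul_sqrt_lt_iff (γsq a b e : ℕ) :
    Real.sqrt γsq * Real.sqrt ((a : ℝ) * b) < (e : ℝ) ↔ γsq * a * b < e * e := by
  rw [← Real.sqrt_mul (Nat.cast_nonneg _), ← mul_assoc]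
  rcases Nat.eq_zero_or_pos e with he | he
  · subst he
    simp only [Nat.cast_zero, not_lt.2 (Real.sqrt_nonneg _), mul_zero, Nat.not_lt_zero]
  · rw [Real.sqrt_lt' (by exact_mod_cast he), sq]
    exact_mod_cast Iff.rfl

/-- A FAILED density test with the count bounded by `e` is the sparsity inequality `c ≤ √γ·√(a·b)`. -/
theorem sparse_of_not_dense_le {γsq a b e c : ℕ} (h : ¬ γsq * a * b < e * e) (hc : c ≤ e) :
    (c : ℝ) ≤ Real.sqrt γsq * Real.sqrt ((a : ℝ) * b) := by
  rw [← sqrt_mul_sqrt_lt_iff] at h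
  exact (Nat.cast_le.2 hc).trans (not_lt.1 h)

/-- Pairs with count `0` are trivially sparse. -/
theorem sparse_of_count_zero {γsq a b c : ℕ} (hc : c = 0) : (c : ℝ) ≤ Real.sqrt γsq * Real.sqrt ((a : ℝ) * b) := by
  subst hc
  simp only [Nat.cast_zero]
  positivity

/-! ## The labelling of the legs -/

variable {L : ℕ} {raw : List RLeg}

/-- The label of position `e`. -/
def labOfG (labels : List ℕ) (e : Fin raw.length) : ℕ := labels.getD e.val 0

/-- The PART of position `e`: `none` = remainder (label `0`), `some s` = spot `s` (label `s + 1`); needs labels `≤ r`. -/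
def pG (labels : List ℕ) (r : ℕ) (hlab : ∀ lab ∈ labels, lab ≤ r) (e : Fin raw.length) : Option (Fin r) :=
  if h : labOfG labels e = 0 then none
  else some ⟨labOfG labels e - 1, by
    have hle : labOfG labels e ≤ r := by
      unfold labOfG
      rw [List.getD_eq_getElem?_getD]
      cases hget : labels[e.val]? with
      | none => simp
      | some a => simpa [hget] using hlab a (List.mem_of_getElem? hget)
    omega⟩

/-- `pG e = none` iff the label is `0`. -/
theorem pG_eq_none_iff (labels : List ℕ) (r : ℕ) (hlab : ∀ lab ∈ labels, lab ≤ r) (e : Fin raw.length) :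
    pG labels r hlab e = none ↔ labOfG labels e = 0 := by
  unfold pG
  split_ifs with h
  · exact ⟨fun _ => h, fun _ => rfl⟩
  · exact ⟨fun h' => absurd h' (by simp), fun h' => absurd h' h⟩

/-- `pG e = some s` iff the label is `s + 1`. -/
theorem pG_eq_some_iff (labels : List ℕ) (r : ℕ) (hlab : ∀ lab ∈ labels, lab ≤ r) (e : Fin raw.length) (s : Fin r) :
    pG labels r hlab e = some s ↔ labOfG labels e = s.val + 1 := by
  unfold pG
  split_ifs with h
  · constructor
    · intro h'; exact absurd h' (by simp)
    · intro h'; omega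
  · rw [Option.some.injEq]
    constructor
    · intro h'; have := congrArg Fin.val h'; simp at this; omega
    · intro h'; apply Fin.ext; simp; omega

/-! ## The sides of the spots -/

section Sides

variable (L : ℕ) (raw : List RLeg) (labels : List ℕ) (r : ℕ) (hlab : ∀ lab ∈ labels, lab ≤ r)

/-- Left side of spot `s`: the left pieces of its legs. -/
def V₁G (s : Fin r) : Finset (LPieceG L raw) :=
  (Finset.univ.filter fun e => pG labels r hlab e = some s).image (srcG L raw)

/-- Right side of spot `s`: the right pieces of its legs. -/
def V₂G (s : Fin r) : Finset (RPieceG L raw) :=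
  (Finset.univ.filter fun e => pG labels r hlab e = some s).image (dstG L raw)

/-- Clause (sides), left. -/
theorem srcG_mem_V₁G {s : Fin r} {e : Fin raw.length} (h : pG labels r hlab e = some s) :
    srcG L raw e ∈ V₁G L raw labels r hlab s :=
  Finset.mem_image.2 ⟨e, Finset.mem_filter.2 ⟨Finset.mem_univ _, h⟩, rfl⟩

/-- Clause (sides), right. -/
theorem dstG_mem_V₂G {s : Fin r} {e : Fin raw.length} (h : pG labels r hlab e = some s) :
    dstG L raw e ∈ V₂G L raw labels r hlab s :=
  Finset.mem_image.2 ⟨e, Finset.mem_filter.2 ⟨Finset.mem_univ _, h⟩, rfl⟩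

/-- Clause (covered): `|V₁ s| + |V₂ s| ≤ 2·#(legs of spot s)`. -/
theorem card_V₁G_add_card_V₂G_le (s : Fin r) :
    (V₁G L raw labels r hlab s).card + (V₂G L raw labels r hlab s).card
      ≤ 2 * (Finset.univ.filter fun e : Fin raw.length => pG labels r hlab e = some s).card := by
  unfold V₁G V₂G
  have h1 := Finset.card_image_le (s := Finset.univ.filter fun e : Fin raw.length => pG labels r hlab e = some s)
    (f := srcG L raw)
  have h2 := Finset.card_image_le (s := Finset.univ.filter fun e : Fin raw.length => pG labels r hlab e = some s)
    (f := dstG L raw)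
  omega

end Sides

/-! ## Counting legs of a spot through the label list -/

/-- Positions satisfying a property of their index are as many as the indices with that property. -/
theorem card_filter_fin_eq {N : ℕ} (P : ℕ → Prop) [DecidablePred P] :
    (Finset.univ.filter fun e : Fin N => P e.val).card = ((List.range N).filter fun i => decide (P i)).length := by
  rw [← List.map_coe_finRange_eq_range, List.filter_map, List.length_map,
    ← List.toFinset_card_of_nodup ((List.nodup_finRange N).filter _), List.toFinset_filter, List.toFinset_finRange]
  congr 1
  ext i
  simp

/-- **#(legs of spot s) = the number of labels equal to `s + 1`.** -/
theorem card_filter_pG_eq_some (labels : List ℕ) (r : ℕ) (hlab : ∀ lab ∈ labels, lab ≤ r)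
    (hlen : labels.length = raw.length) (s : Fin r) :
    (Finset.univ.filter fun e : Fin raw.length => pG labels r hlab e = some s).card = labels.count (s.val + 1) := by
  have : (Finset.univ.filter fun e : Fin raw.length => pG labels r hlab e = some s)
      = Finset.univ.filter fun e : Fin raw.length => labels.getD e.val 0 = s.val + 1 :=
    Finset.filter_congr fun e _ => pG_eq_some_iff labels r hlab e s
  rw [this, card_filter_fin_eq (fun i => labels.getD i 0 = s.val + 1), count_eq_length_filter_range, hlen]

/-! ## Clause (dense) -/

/-- The sides of spot `s` lie inside the sides of the candidate pair it was extracted from. -/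
theorem card_V₁G_le_of_spotInv (L : ℕ) (raw : List RLeg) (labels : List ℕ) (r : ℕ)
    (hlab : ∀ lab ∈ labels, lab ≤ r) (hlen : labels.length = raw.length) (s : Fin r) (W : Cand)
    (hgeo : ∀ (i : ℕ) (hi : i < labels.length) (hp : i < (pieceLegsG L raw).length),
      labels[i] = s.val + 1 → labL (pieceLegsG L raw)[i] ∈ W.1 ∧ labR (pieceLegsG L raw)[i] ∈ W.2) :
    (V₁G L raw labels r hlab s).card ≤ W.1.length ∧ (V₂G L raw labels r hlab s).card ≤ W.2.length := by
  classical
  have key : ∀ e : Fin raw.length, pG labels r hlab e = some s →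
      labL (plegOfG L raw e) ∈ W.1 ∧ labR (plegOfG L raw e) ∈ W.2 := by
    intro e he
    rw [pG_eq_some_iff] at he
    have hi : e.val < labels.length := by rw [hlen]; exact e.isLt
    have hp : e.val < (pieceLegsG L raw).length := by rw [length_pieceLegsG]; exact e.isLt
    have hlabi : labels[e.val] = s.val + 1 := by
      unfold labOfG at he; rwa [List.getD_eq_getElem _ _ hi] at he
    have h := hgeo e.val hi hp hlabi
    rwa [pieceLegsG_getElem] at h
  constructor
  · calc (V₁G L raw labels r hlab s).card = ((V₁G L raw labels r hlab s).image Subtype.val).card :=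
          (Finset.card_image_of_injective _ Subtype.val_injective).symm
      _ ≤ W.1.toFinset.card := Finset.card_le_card (fun P hP => by
          obtain ⟨x, hx, rfl⟩ := Finset.mem_image.1 hP
          unfold V₁G at hx
          obtain ⟨e, he, rfl⟩ := Finset.mem_image.1 hx
          exact List.mem_toFinset.2 (key e (Finset.mem_filter.1 he).2).1)
      _ ≤ W.1.length := List.toFinset_card_le _
  · calc (V₂G L raw labels r hlab s).card = ((V₂G L raw labels r hlab s).image Subtype.val).card :=
          (Finset.card_image_of_injective _ Subtype.val_injective).symm
      _ ≤ W.2.toFinset.card := Finset.card_le_card (fun P hP => by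
          obtain ⟨x, hx, rfl⟩ := Finset.mem_image.1 hP
          unfold V₂G at hx
          obtain ⟨e, he, rfl⟩ := Finset.mem_image.1 hx
          exact List.mem_toFinset.2 (key e (Finset.mem_filter.1 he).2).2)
      _ ≤ W.2.length := List.toFinset_card_le _

/-- **Clause (dense) for the COMPUTED decomposition**, threshold `√γsq`: every spot of an extraction state carrying the
spot invariant `SpotInv γsq` (e.g. `extract γsq …`, by `spotInv_extract`) is dense. -/
theorem dense_V₁G_V₂G (γsq L : ℕ) (raw : List RLeg) (cs : List Cand) (st : List ℕ × ℕ)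
    (hlab : ∀ lab ∈ st.1, lab ≤ st.2) (hlen : st.1.length = raw.length)
    (hS : SpotInv γsq (pieceLegsG L raw) cs st) (s : Fin st.2) :
    Real.sqrt γsq * Real.sqrt (((V₁G L raw st.1 st.2 hlab s).card : ℝ) * ((V₂G L raw st.1 st.2 hlab s).card : ℝ))
      < ((Finset.univ.filter fun e : Fin raw.length => pG st.1 st.2 hlab e = some s).card : ℝ) := by
  obtain ⟨W, _, hgeo, hdense⟩ := hS s.val s.isLt
  obtain ⟨h1, h2⟩ := card_V₁G_le_of_spotInv L raw st.1 st.2 hlab hlen s W hgeo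
  rw [card_filter_pG_eq_some st.1 st.2 hlab hlen s]
  refine (sqrt_mul_sqrt_lt_iff _ _ _ _).2 ?_
  calc γsq * (V₁G L raw st.1 st.2 hlab s).card * (V₂G L raw st.1 st.2 hlab s).card
      ≤ γsq * W.1.length * W.2.length := Nat.mul_le_mul (Nat.mul_le_mul_left _ h1) h2
    _ < st.1.count (s.val + 1) * st.1.count (s.val + 1) := hdense

end Summit.PneNP.PneNP.Theorems.Sd2BlMachine
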